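import Mathlib.Data.List.OfFn
import Mathlib.Order.PiLex
import HarnessLib

/-!
# Venture HSemireg — THE LEX-LEADER CHAIN CLAUSES ENCODE `x ≥_lex σ·x` (kernel form of the encoder half of premise NEW-3)

Companion of `Summits/Ventures/HSemireg/LexLeaderSoundness.lean` (ladder row 264).  That file proves, for a
finite group of syntactic symmetries of a formula, that adding any family of side constraints IMPLIED by
orbit-maximality under a linear order leaves satisfiability unchanged.  The symmetry-breaking legs of the
door-(I) TRIPLE-PIN campaign on encoder B (cell pub-hsemireg, seat s0-2; `step0/B/RESULT-B21.md` §3; code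
`step0/B/code/kit/job_c9xl4/stabsym.py`, function `add_lexstab`, used by `c9xlazy.py` v10.11 `--lexstab`)
realise the side constraint «`x ≥_lex y`» — where `yᵢ = x_{σ(i)}`, i.e. `y = σ⁻¹·x` for the left action
`(σ·x)ᵢ = x_{σ⁻¹(i)}`; `LexLeader.sat_iff_sat_weaker` allows ANY sub-family of the group, so chaining `σ⁻¹`
for the chosen generators `σ` is covered — by the linear CHAIN encoding (one auxiliary «all earlier
positions agree» variable per compared position, as in Shatter: Aloul–Markov–Sakallah, DAC 2003 ∕ IEEE Trans.
Computers 55 (2006)) of the lex-leader predicates of Crawford–Ginsberg–Luks–Roy (KR 1996) and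
Aloul–Ramani–Markov–Sakallah (IEEE TCAD 2003, §3.1 eq. (2)–(3), there with all earlier equality auxiliaries
in each clause instead of a chained accumulator):
at the `k`-th compared position, with `p` = the auxiliary of the previous position («all earlier compared
positions agree»; read `p = true` at the first position) and a fresh auxiliary `e`,

* the comparison clause `¬p ∨ x ∨ ¬y`;
* the definition `e ↔ (p ∧ (x ↔ y))` as the five clauses `¬e ∨ p`, `¬e ∨ ¬x ∨ y`, `¬e ∨ x ∨ ¬y`,
  `e ∨ ¬p ∨ ¬x ∨ ¬y`, `e ∨ ¬p ∨ x ∨ y` (at the first position the code omits `¬e ∨ p` and drops `¬p` — the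
  same clauses with `p := true`).

Positions `i` with `σ(i) = i` are skipped by the code (there `yᵢ = xᵢ` identically), and the chain runs over a
σ-invariant PREFIX of the variable order only (the same order for every chained `σ`, as one linear order on
assignments requires).

WHAT IS PROVED (Booleans and lists only; `true > false`; positions in decreasing significance; every clause
set is written as a `Bool`-valued evaluation, `= true` meaning «all clauses satisfied»):
* `tseitin_iff`        : the five definition clauses hold iff `e = (p && (x == y))`.
* `chainSat_iff`       : auxiliary values satisfying the whole chain exist iff (`p = true →` the compared
                         pairs satisfy `lexGE`), by induction on the positions; in particular
  `chain_sat_iff_lexGE`: from `p = true` the chain is satisfiable iff `x ≥_lex y` on the compared positions,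
  and `lexGE_of_chainSat` is the direction an UNSAT verdict uses.
* `lexGE_iff_not_lex_lt` : `lexGE (zip xs ys)` is `¬ (xs <_lex ys)` (`List.Lex (· < ·)` on `Bool`, equal
                         lengths) — the encoded constraint is the weak lexicographic comparison `σ·a ≤ a` of
                         `LexLeaderSoundness`.
* `lexGE_skip_eq`, `lexGE_filter_ne` : inserting / dropping positions with `x = y` does not change `lexGE`
                         (the code chains only the positions moved by `σ` — exact); `lexGE_eq_first_ne`: the
                         comparison is decided by the first unequal pair.
* `lexGE_take`         : `lexGE l → lexGE (l.take n)` (a prefix chain is IMPLIED by the full comparison — the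
                         hypothesis `hC` of `LexLeader.sat_iff_sat_weaker`).
* `lexGE_ofFn_iff`, `chain_satisfiable_of_not_lex_lt` (GLUE to `LexLeaderSoundness`): for vectors
                         `a b : Fin n → Bool`, `lexGE` of the position list is `¬ (toLex a < toLex b)` in Mathlib's
                         `Lex (Fin n → Bool)`; hence an assignment not lex-below its image `a ∘ σ` (e.g. the
                         maximum of its orbit) satisfies the chain for `σ` — full, moved-positions-only, any prefix.

HONEST FRAMING.  Propositional bookkeeping about one clause gadget; no SAT solver, no geometry, no group.
That the permutations fed to the gadget are symmetries of encoder B's clause families (NEW-1) and form the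
set-wise seed stabiliser (NEW-2) are separate machine-checked premises, not theorems of this file.  Nothing
here bears on HC ∕ HC_CM ∕ HC_AV.
-/

namespace Summit.Ventures.HSemireg
namespace LexChain

/-- Weak lexicographic comparison `x ≥_lex y` of two Boolean vectors presented as the list of coordinate
pairs `(xᵢ, yᵢ)` in decreasing significance (`true > false`), as a Boolean. -/
def lexGE : List (Bool × Bool) → Bool
  | [] => true
  | (x, y) :: t => (x && !y) || (x == y && lexGE t)

/-- Evaluation of the comparison clause `¬p ∨ x ∨ ¬y` of one chain position. -/
def cmpClause (p x y : Bool) : Bool := !p || x || !y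

/-- Evaluation of the five clauses defining the auxiliary `e ↔ (p ∧ (x ↔ y))` of one chain position
(`stabsym.add_lexstab`: `[-ev, prev]`, `[-ev, -xi, xj]`, `[-ev, xi, -xj]`, `[ev, -prev, -xi, -xj]`, `[ev, -prev, xi, xj]`). -/
def tseitin (e p x y : Bool) : Bool :=
  (!e || p) && (!e || !x || y) && (!e || x || !y) && (e || !p || !x || !y) && (e || !p || x || y)

/-- Evaluation of the whole chain: `p` = value of the previous auxiliary (`true` before the first position),
the compared pairs, and the chosen auxiliary values (one per position; a length mismatch evaluates to `false`). -/
def chainSat : Bool → List (Bool × Bool) → List Bool → Bool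
  | _, [], [] => true
  | p, (x, y) :: t, e :: es => cmpClause p x y && tseitin e p x y && chainSat e t es
  | _, [], _ :: _ => false
  | _, _ :: _, [] => false

/-- The definition clauses pin the auxiliary: `e = (p && (x == y))`. -/
theorem tseitin_iff (e p x y : Bool) : tseitin e p x y = true ↔ e = (p && (x == y)) := by
  revert e p x y
  decide

/-- One position of the chain, with its auxiliary eliminated. -/
theorem chainSat_cons_iff (p x y : Bool) (t : List (Bool × Bool)) :
    (∃ es, chainSat p ((x, y) :: t) es = true) ↔
      cmpClause p x y = true ∧ ∃ es, chainSat (p && (x == y)) t es = true := by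
  constructor
  · rintro ⟨es, h⟩
    match es, h with
    | e :: es', h =>
      simp only [chainSat, Bool.and_eq_true] at h
      obtain ⟨⟨hc, ht⟩, hrest⟩ := h
      rw [tseitin_iff] at ht
      subst ht
      exact ⟨hc, es', hrest⟩
  · rintro ⟨hc, es', hrest⟩
    refine ⟨(p && (x == y)) :: es', ?_⟩
    simp only [chainSat, Bool.and_eq_true]
    exact ⟨⟨hc, (tseitin_iff _ _ _ _).mpr rfl⟩, hrest⟩

/-- THE CHAIN ENCODES THE COMPARISON: auxiliary values satisfying every clause exist iff, provided all
earlier positions agree (`p = true`), the compared positions satisfy `x ≥_lex y`. -/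
theorem chainSat_iff (l : List (Bool × Bool)) (p : Bool) :
    (∃ es, chainSat p l es = true) ↔ (p = true → lexGE l = true) := by
  induction l generalizing p with
  | nil =>
    constructor
    · intro _ _; rfl
    · intro _; exact ⟨[], rfl⟩
  | cons hd t ih =>
    obtain ⟨x, y⟩ := hd
    rw [chainSat_cons_iff, ih]
    simp only [lexGE, cmpClause]
    generalize lexGE t = r
    revert p x y r
    decide

/-- From the start of the chain (`p = true`): satisfiable iff `x ≥_lex y` on the compared positions. -/
theorem chain_sat_iff_lexGE (l : List (Bool × Bool)) : (∃ es, chainSat true l es = true) ↔ lexGE l = true := by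
  rw [chainSat_iff]; simp

/-- Direction used by a verdict: any assignment satisfying the chain clauses has `x ≥_lex y` (so a model of
`F ∧ chains` satisfies `x ≥_lex σ·x` for every chained `σ`; and if `x ≥_lex y` then SOME auxiliary values
satisfy the chain, which is what soundness needs). -/
theorem lexGE_of_chainSat {l : List (Bool × Bool)} {es : List Bool} (h : chainSat true l es = true) :
    lexGE l = true :=
  (chain_sat_iff_lexGE l).mp ⟨es, h⟩

/-- `lexGE` on `zip xs ys` (equal lengths) is the negation of the STRICT lexicographic order `xs <_lex ys`
of `List.Lex (· < ·)` over `Bool` (`false < true`) — i.e. the weak comparison `ys ≤ xs` of a linear order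
on vectors, as in `LexLeaderSoundness`. -/
theorem lexGE_iff_not_lex_lt (xs ys : List Bool) (hlen : xs.length = ys.length) :
    lexGE (xs.zip ys) = true ↔ ¬ List.Lex (· < ·) xs ys := by
  induction xs generalizing ys with
  | nil =>
    cases ys with
    | nil => simp [lexGE, List.not_lex_nil]
    | cons y yt => simp at hlen
  | cons x xt ih =>
    cases ys with
    | nil => simp at hlen
    | cons y yt =>
      simp only [List.length_cons, Nat.add_right_cancel_iff] at hlen
      have ih' := ih yt hlen
      rw [List.zip_cons_cons, List.cons_lex_cons_iff]
      simp only [lexGE]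
      by_cases hL : List.Lex (· < ·) xt yt
      · have hq : lexGE (xt.zip yt) = false := by
          cases hq' : lexGE (xt.zip yt)
          · rfl
          · exact absurd hL (ih'.mp hq')
        rw [hq]
        simp only [hL, and_true]
        revert x y; decide
      · have hq : lexGE (xt.zip yt) = true := ih'.mpr hL
        rw [hq]
        simp only [hL, and_false, or_false]
        revert x y; decide

/-- Skipping a position where the two vectors agree (the code skips `i` with `σ(i) = i`) is exact. -/
theorem lexGE_skip_eq (l₁ l₂ : List (Bool × Bool)) (b : Bool) :
    lexGE (l₁ ++ (b, b) :: l₂) = lexGE (l₁ ++ l₂) := by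
  induction l₁ with
  | nil => cases b <;> simp [lexGE]
  | cons hd t ih =>
    obtain ⟨x, y⟩ := hd
    simp only [List.cons_append, lexGE, ih]

/-- Dropping EVERY position where the two vectors agree is exact (general form of `lexGE_skip_eq`; the code
keeps only the positions moved by `σ`, and at a moved position whose values happen to agree the pair is
again an equal pair): `lexGE` only ever looks at the first unequal pair. -/
theorem lexGE_filter_ne (l : List (Bool × Bool)) :
    lexGE (l.filter fun q => q.1 != q.2) = lexGE l := by
  induction l with
  | nil => rfl
  | cons hd t ih =>
    obtain ⟨x, y⟩ := hd
    cases x <;> cases y <;> simp [lexGE, ih]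

/-- `x ≥_lex y` is decided by the FIRST unequal pair: it holds iff there is none or that pair is `(true, false)`. -/
theorem lexGE_eq_first_ne (l : List (Bool × Bool)) :
    lexGE l = ((l.find? fun q => q.1 != q.2).map Prod.fst).getD true := by
  induction l with
  | nil => rfl
  | cons hd t ih =>
    obtain ⟨x, y⟩ := hd
    cases x <;> cases y <;> simp [lexGE, ih]

/-- A prefix chain is implied by the full comparison: `x ≥_lex y ⇒ x|ₙ ≥_lex y|ₙ` — the hypothesis
`hC` of `LexLeader.sat_iff_sat_weaker` for prefix-truncated chains. -/
theorem lexGE_take (l : List (Bool × Bool)) (n : ℕ) (h : lexGE l = true) : lexGE (l.take n) = true := by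
  induction l generalizing n with
  | nil => simpa using h
  | cons hd t ih =>
    obtain ⟨x, y⟩ := hd
    cases n with
    | zero => simp [lexGE]
    | succ n =>
      simp only [List.take_succ_cons, lexGE, Bool.or_eq_true, Bool.and_eq_true] at h ⊢
      rcases h with h | ⟨hxy, ht⟩
      · exact Or.inl h
      · exact Or.inr ⟨hxy, ih n ht⟩

/-- `x ≥_lex x`: on a vector fixed by `σ` the chain is always satisfiable. -/
theorem lexGE_refl (xs : List Bool) : lexGE (xs.zip xs) = true := by
  induction xs with
  | nil => rfl
  | cons x t ih =>
    simp only [List.zip_cons_cons, lexGE, Bool.or_eq_true, Bool.and_eq_true]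
    exact Or.inr ⟨by simp, ih⟩

/-! ### Glue to `LexLeaderSoundness`: vectors `Fin n → Bool` under Mathlib's lexicographic order `Pi.Lex`

`LexLeader.exists_orbit_max` delivers a witness that is maximal in its orbit for a linear order on assignments;
for the order `Lex (Fin n → Bool)` (= `Pi.Lex (· < ·) (· < ·)`, positions `0 < 1 < ⋯`, `false < true`)
maximality against the image `a ∘ σ` says `¬ (a <_lex a ∘ σ)`, and that is exactly `lexGE` of the position
list — so the chain for `σ` is satisfiable (`chain_satisfiable_of_not_lex_lt`), also after dropping the fixed
positions and truncating to a prefix. -/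

/-- `lexGE` of the full position list of two vectors `a b : Fin n → Bool` is the negation of Mathlib's strict
lexicographic relation `Pi.Lex (· < ·) (· < ·) a b` («`b` exceeds `a` at the first position where they differ»). -/
theorem lexGE_ofFn_iff {n : ℕ} (a b : Fin n → Bool) :
    lexGE (List.ofFn fun i => (a i, b i)) = true ↔ ¬ Pi.Lex (· < ·) (fun {_} => (· < ·)) a b := by
  induction n with
  | zero =>
    simp only [List.ofFn_zero, lexGE, Pi.Lex, true_iff]
    rintro ⟨i, -, -⟩
    exact i.elim0
  | succ n ih =>
    have ih' := ih (fun i => a i.succ) (fun i => b i.succ)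
    rw [List.ofFn_succ]
    simp only [lexGE, Pi.Lex] at ih' ⊢
    rw [Fin.exists_fin_succ]
    simp only [Fin.not_lt_zero, IsEmpty.forall_iff, implies_true, true_and, Fin.forall_fin_succ,
      Fin.succ_pos, forall_const, Fin.succ_lt_succ_iff]
    -- goal: ((a 0 && !b 0) || (a 0 == b 0 && lexGE tail)) = true ↔ ¬(a 0 < b 0 ∨ ∃ i, (a 0 = b 0 ∧ ∀ j < i, …) ∧ …)
    by_cases hL : ∃ i : Fin n, (∀ j, j < i → a j.succ = b j.succ) ∧ a i.succ < b i.succ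
    · have hq : lexGE (List.ofFn fun i : Fin n => (a i.succ, b i.succ)) = false := by
        cases hq' : lexGE (List.ofFn fun i : Fin n => (a i.succ, b i.succ))
        · rfl
        · exact absurd hL (ih'.mp hq')
      rw [hq]
      have hL' : ∀ P : Prop, (∃ i : Fin n, (P ∧ ∀ j, j < i → a j.succ = b j.succ) ∧ a i.succ < b i.succ) ↔
          P ∧ ∃ i : Fin n, (∀ j, j < i → a j.succ = b j.succ) ∧ a i.succ < b i.succ := fun P =>
        ⟨fun ⟨i, ⟨hP, hj⟩, hi⟩ => ⟨hP, i, hj, hi⟩, fun ⟨hP, i, hj, hi⟩ => ⟨i, ⟨hP, hj⟩, hi⟩⟩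
      rw [hL']
      simp only [hL, and_true]
      generalize a 0 = x; generalize b 0 = y
      revert x y; decide
    · have hq : lexGE (List.ofFn fun i : Fin n => (a i.succ, b i.succ)) = true := ih'.mpr hL
      rw [hq]
      have hL' : ∀ P : Prop, (∃ i : Fin n, (P ∧ ∀ j, j < i → a j.succ = b j.succ) ∧ a i.succ < b i.succ) ↔
          P ∧ ∃ i : Fin n, (∀ j, j < i → a j.succ = b j.succ) ∧ a i.succ < b i.succ := fun P =>
        ⟨fun ⟨i, ⟨hP, hj⟩, hi⟩ => ⟨hP, i, hj, hi⟩, fun ⟨hP, i, hj, hi⟩ => ⟨i, ⟨hP, hj⟩, hi⟩⟩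
      rw [hL']
      simp only [hL, and_false, or_false]
      generalize a 0 = x; generalize b 0 = y
      revert x y; decide

/-- The same through Mathlib's type synonym: `lexGE` of the position list is `¬ (toLex a < toLex b)` in the
linear order `Lex (Fin n → Bool)` — the order in which `LexLeader.exists_orbit_max` may be instantiated. -/
theorem lexGE_ofFn_iff_not_toLex_lt {n : ℕ} (a b : Fin n → Bool) :
    lexGE (List.ofFn fun i => (a i, b i)) = true ↔ ¬ toLex a < toLex b :=
  lexGE_ofFn_iff a b

/-- GLUE.  If the assignment `a` is not lexicographically below its image `a ∘ σ` (e.g. `a` is the maximum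
of its orbit, `LexLeader.exists_orbit_max`), then the chain emitted for `σ` — over ALL positions, over the
positions MOVED by `σ` only (what `stabsym.add_lexstab` emits), or over any PREFIX of either — is satisfiable
by suitable auxiliary values.  This is the hypothesis `hC` of `LexLeader.sat_iff_sat_weaker` for the chains. -/
theorem chain_satisfiable_of_not_lex_lt {n : ℕ} (a : Fin n → Bool) (σ : Equiv.Perm (Fin n))
    (h : ¬ toLex a < toLex (a ∘ σ)) (m : ℕ) :
    (∃ es, chainSat true ((List.ofFn fun i => (a i, a (σ i))).take m) es = true) ∧
    (∃ es, chainSat true (((List.ofFn fun i => (a i, a (σ i))).filter fun q => q.1 != q.2).take m) es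
      = true) := by
  have hfull : lexGE (List.ofFn fun i => (a i, a (σ i))) = true :=
    (lexGE_ofFn_iff_not_toLex_lt a (a ∘ σ)).mpr h
  refine ⟨(chain_sat_iff_lexGE _).mpr (lexGE_take _ m hfull), (chain_sat_iff_lexGE _).mpr (lexGE_take _ m ?_)⟩
  rw [lexGE_filter_ne]; exact hfull

end LexChain
end Summit.Ventures.HSemireg
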